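import Summits.BirchSwinnertonDyer.BirchSwinnertonDyer.Theorems.SignedLowerHalvesKobayashiLowerHalfSemistableDefmuAssemblyStubs
import Literature.NumberTheory.EllipticCurves.GrossPointsThetaElementSupersingular
import Literature.NumberTheory.EllipticCurves.Rank1Residual.Typed.X6
import Literature.NumberTheory.EllipticCurves.LFunctionPrimeCoeff
import Literature.NumberTheory.QuadraticFields.KroneckerSplitting
import HarnessLib

/-!
# Line «defmu» of crux 2 `KobayashiLowerHalfSemistable` (stmt-BirchSwinnertonDyer-19000), reshape v3: the stub Cμ
# (`stub_definitePackageMu`) split along the anticyclotomic `μ`-seam — (P4a) Pollack–Weston 2011 Thm. 2.5 BY NAME,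
# (P4b) the package with a DEFINITE `μ`-CARRIER; this file is the kernel step (P4a) ⊕ (P4b) ⟹ Cμ

Route-independent `Theorems` file of the cell `bsd-ssimc`, seat `bsd-line-slh-p2` (LEAD of crux 2, gen 13). HONEST FRAMING:
nothing about any curve is asserted, NO summit statement is proved, BSD / the crux is NOT proved; every theorem is an
IMPLICATION from hypotheses displayed in full.

The registered stub Cμ of `Cruxes/KobayashiLowerHalfSemistable/Lines/defmu.lean` (v2, sha256 ac2ff305…) is the tree's PRE binder
`props118_27_519_exists_signedTwoVariablePackage_supersingular_PRE` (BSTW Props. 1.18 / 2.7 / 5.19) at the definite-CR datum ⊕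
ONE extra conjunct `GreenbergVatsal2000.HasUnitContent (UnrSeries₂.minus Lsig)` — unit content of the signed two-variable
`p`-adic `L`-function `𝓛^∘_p(g_{/L})` on the ANTICYCLOTOMIC line (`UnrSeries₂.minus` kills the outer, cyclotomic, variable;
LEAD gen 11, `PICKED.md` addendum 6, located this as the exact token difference). In print ([BSTW-II] §2.2.2, proof of the
two-variable `±`-divisibility, case (def); store text `paper:arxiv-2409.01350` p0075 L140 – p0076 L8) that conjunct is two steps:
(P4a) "`μ(𝓛^∘_𝒲(g_{/L})) = 0` by [PW]. Here `𝓛^∘_𝒲(g_{/L})` is the `∘`-anticyclotomic `p`-adic `L`-function whose construction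
  is based on the Waldspurger formula on the definite quaternion algebra ramified at the primes dividing `N⁻∞`" — Pollack–Weston
  2011 Thm. 2.5 (i), since 2026-08-28 a NAMED FACT of the tree: `pollackWeston2011_thm_2_5_hasMuZeroLAc` (file
  `GrossPointsThetaElementSupersingular`, cite item wi-88398), in the finite-level form `GrossPointTower.HasMuZeroLAc`
  ("`μ(L_n) = 0` for `n` large", `L_n ∈ ℤ_p[G̃_{n+1}/Δ]` Darmon–Iovita's elements of a tower of Gross points);
(P4b) "In view of the interpolation formulas for the underlying `p`-adic `L`-functions, it follows that
  `(𝓛^{∘,ac}_p(g_{/L})) = (∏_{q ∣ N⁻} c_q(g) · 𝓛^∘_𝒲(g_{/L}))`. Note that the Tamagawa numbers `c_q(g)` are `p`-indivisible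
  under the hypothesis (ram), and so `μ(𝓛^∘_p(g_{/L})) = 0`" — a PREPRINT comparison. The reshaped stub Cμ′
  (`stub_definitePackageMuCarrier` of `Lines/defmu.lean` v3) carries its `μ`-CONTENT in the tree's vocabulary: a DEFINITE
  `μ`-CARRIER — a Brandt setup `S` of type `(N/q₀, q₀)` (the definite quaternion algebra ramified at `q₀ ∞` with an Eichler
  order of level `N/q₀`), a generator `φ` of the `a(W)`-eigen-line of its Brandt module normalised as in PW Lemma 2.1, a tower
  `T` of Gross points of `p`-power conductor — such that `μ(L_n) = 0 (n ≫ 0) ⟹ μ(𝓛^{∘,ac}_p) = 0`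
  (`T.HasMuZeroLAc p φ → HasUnitContent (UnrSeries₂.minus Lsig)`): the `μ`-shadow of the printed ideal equality (WEAKER than
  print: one direction, `μ = 0` only). How a genuine comparison "`UnrSeries₂.minus Lsig = w · λ`, `w` a unit, `λ ∈ ℤ_p⟦T⟧`
  Darmon–Iovita's `L_f^∘` pinned to the `L_n` (Prop. 2.8: `L_n = ω̃_n^{−ε} L_n^ε`)" yields this implication is the typer's PROVED
  transfer `GrossPointTower.HasMuZeroLAc.hasUnitContent_of_pinned` ⊕ `hasUnitContent_mul_iff_of_isUnit` (not restated here: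
  under this file's import closure the group-ring instance `MonoidAlgebra ℤ_[p] (G̃_{n+1}/Δ)` is out of budget, as that file's
  docstring warns — which is also why Cμ′ speaks through `HasMuZeroLAc`, whose type only mentions coefficients).

This file PROVES, in the kernel: Cμ′ ⊕ [PW Thm. 2.5 by name] ⟹ Cμ pointwise (`exists_package_of_muCarrier`), with the
bookkeeping that turns the datum of Cμ into Pollack–Weston's hypotheses (`hasMuZeroLAc_of_pollackWeston`: `N = (N/q₀)·q₀`
square-free from semistability, `(N p, D_K) = 1` from `(N, D_K) = 1` and `p` split, split/inert primes of `N/q₀` and `q₀`,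
`a_p(E) = 0` from `frobeniusTrace = 0` at the good prime `p`, `ρ̄_{E,p}` irreducible from `ClassX6.irr`). The companion file
`…DefmuMuCarrierStubs.lean` assembles the route decl's BODY from the five v3 stub signatures.

Kernel state of the crux after this file: UNCHANGED (OPEN; PRE). Nothing of BSTW is asserted.

References: [BurungaleSkinnerTianWan2024] arXiv:2409.01350v2 II §2.2.2 (proof, case (def)), Props. 1.18/2.7/5.19;
[PollackWeston2011] Compos. Math. 147 (2011) §2.1 Lemma 2.1, Thm. 2.5 (i) and its proof; [DarmonIovita2008] J. Inst. Math.
Jussieu 7 (2008) §2.2, Prop. 2.8; cell files `Cruxes/KobayashiLowerHalfSemistable/{Lines/defmu.lean, PICKED.md}`.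
-/

-- D-0017: single-problem summit, the namespace repeats the problem name by design.
set_option linter.dupNamespace false
set_option autoImplicit false

noncomputable section

open scoped Classical

open NumberField IsDedekindDomain Field CongruenceSubgroup
open Literature.NumberTheory.GaloisRepresentations
open Literature.NumberTheory.EllipticCurves Literature.NumberTheory.EllipticCurves.BurungaleSkinnerTianWan2024
open Literature.NumberTheory.EllipticCurves.ModularForms
open Literature.NumberTheory.Automorphic

namespace Summit.BirchSwinnertonDyer.BirchSwinnertonDyer.Theorems.SemistableDefmuMuCarrier

/-! ### §1. Bookkeeping: the definite-CR datum of Cμ supplies Pollack–Weston's hypotheses -/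

/-- `(N, D_K) = 1` and `p` split in the imaginary quadratic field `K` (`p` odd) give `(N p, D_K) = 1` in the `ℕ`-form of the
Gross-points facts: a split odd prime does not divide the discriminant (decomposition law, `(D_K/p) = 1`). [folklore] -/
theorem coprime_mul_discr_of_split {K : Type} [Field K] [NumberField K] (hIQ : IsImaginaryQuadratic K) {p : ℕ}
    [Fact p.Prime] (hp : p ≠ 2) (hsp : ((Ideal.span {(p : ℤ)}).primesOver (𝓞 K)).ncard = 2) {N : ℕ}
    (hcop : IsCoprime (N : ℤ) (NumberField.discr K)) :
    (N * p).Coprime (NumberField.discr K).natAbs := by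
  refine Nat.Coprime.mul_left ?_ ?_
  · have h := Int.isCoprime_iff_gcd_eq_one.mp hcop
    rwa [Int.gcd_eq_natAbs, Int.natAbs_natCast] at h
  · rw [Nat.Prime.coprime_iff_not_dvd Fact.out]
    intro hdvd
    have hleg : legendreSym p (NumberField.discr K) = 1 :=
      (Literature.NumberTheory.QuadraticFields.Quadratic.ncard_primesOver_eq_two_iff_legendreSym hIQ.1 hp).mp hsp
    have hzero : legendreSym p (NumberField.discr K) = 0 :=
      (legendreSym.eq_zero_iff p _).mpr
        ((ZMod.intCast_zmod_eq_zero_iff_dvd _ p).mpr (Int.natCast_dvd.mpr hdvd))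
    rw [hzero] at hleg
    exact zero_ne_one hleg

/-- The primes of `N/q₀` are primes `ℓ ∣ N` with `ℓ ≠ q₀` when `q₀ ∥ N` (`q₀ ∣ N`, `q₀² ∤ N`). [folklore] -/
theorem ne_of_dvd_div {N q₀ ℓ : ℕ} (hqN : q₀ ∣ N) (hq2 : ¬ (q₀ ^ 2 ∣ N)) (hℓ : ℓ ∣ N / q₀) : ℓ ∣ N ∧ ℓ ≠ q₀ := by
  refine ⟨hℓ.trans (Nat.div_dvd_of_dvd hqN), ?_⟩
  rintro rfl
  exact hq2 (by rw [sq]; exact (Nat.dvd_div_iff_mul_dvd hqN).mp hℓ)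

/-- **Pollack–Weston's `μ(L_n) = 0` at the definite-CR datum of Cμ, from the named fact.** For `W/ℚ` globally minimal
with `ClassX6 W p` (`p` odd good supersingular, semistable), `N = N_W`, `a_p = 0`, `K` imaginary quadratic with `p` split
and `(N, D_K) = 1`, and a prime `q₀ ∥ N` inert in `K` with every other `ℓ ∣ N` split: every Brandt setup `S` of type
`(N/q₀, q₀)`, every generator `φ` of the `a(W)`-eigen-line normalised as in PW Lemma 2.1, and every tower `T` of Gross points
of `p`-power conductor satisfy `T.HasMuZeroLAc p φ` — GRANTED `pollackWeston2011_thm_2_5_hasMuZeroLAc` (hypothesis `hPW`),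
whose premises are discharged here: `(N/q₀)·q₀ = N = N_W` square-free (semistability, `isSemistable_iff_squarefree_conductorNorm`),
`(N p, D_K) = 1` (`coprime_mul_discr_of_split`), `p ∤ N` (good reduction), split/inert primes (`ne_of_dvd_div`),
`a_p(W) = W.LFunction p = 0` (`LFunction_apply_prime_eq_frobeniusTrace`), `ρ̄_{W,p}` irreducible (`ClassX6.irr`).
CONDITIONAL on `hPW` (a PUBLISHED named fact); closes nothing. [cite: PollackWeston2011, Thm. 2.5 (i)] -/
theorem hasMuZeroLAc_of_pollackWeston
    (hPW : ∀ (K : Type) [Field K] [NumberField K] {Nplus Nminus : ℕ} (S : Brandt.XiSetup Nplus Nminus)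
      (p : ℕ) [Fact p.Prime] (W : WeierstrassCurve ℚ), pollackWeston2011_thm_2_5_hasMuZeroLAc K S p W)
    {p : ℕ} [Fact p.Prime] (W : WeierstrassCurve ℚ) [W.IsElliptic] [W.IsGloballyMinimal]
    (K : Type) [Field K] [NumberField K] {N : ℕ} (hN : (N : ℤ) = W.conductorNorm ℤ) (hp : p ≠ 2)
    (ha0 : W.frobeniusTrace p = 0) (hIQ : IsImaginaryQuadratic K)
    (hsp : ((Ideal.span {(p : ℤ)}).primesOver (𝓞 K)).ncard = 2) (hcop : IsCoprime (N : ℤ) (NumberField.discr K))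
    (hX : Rank1Residual.ClassX6 W p) {q₀ : ℕ} (hq₀ : q₀.Prime) (hqN : q₀ ∣ N) (hq2 : ¬ (q₀ ^ 2 ∣ N))
    (hin : ((Ideal.span {(q₀ : ℤ)}).primesOver (𝓞 K)).ncard = 1)
    (hspl : ∀ ℓ : ℕ, ℓ.Prime → ℓ ∣ N → ℓ ≠ q₀ → ((Ideal.span {(ℓ : ℤ)}).primesOver (𝓞 K)).ncard = 2)
    (S : Brandt.XiSetup (N / q₀) q₀) [Fintype (Brandt.ClassSet S.O)] (φ : Brandt.ClassSet S.O → ℤ) (hφ0 : φ ≠ 0)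
    (hφ : Brandt.eigenLattice (N / q₀ * q₀) (Brandt.matrix S.O) (fun n => W.LFunction n) = ℤ ∙ φ)
    (hnorm : ∃ c : Brandt.ClassSet S.O, ¬ (p : ℤ) ∣ (Brandt.weight S.O c : ℤ) * φ c)
    (T : GrossPointTower K S p) : T.HasMuZeroLAc p φ := by
  have hNnat : N = W.conductorNorm ℤ := by exact_mod_cast hN
  have hmul : N / q₀ * q₀ = N := Nat.div_mul_cancel hqN
  have hNc : N / q₀ * q₀ = W.conductorNorm ℤ := hmul.trans hNnat
  have hsq : Squarefree (N / q₀ * q₀) := by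
    rw [hNc]
    exact (W.isSemistable_iff_squarefree_conductorNorm).mp
      ((Rank1Residual.semistable_iff_isSemistable_int (W := W)).mp hX.2.1)
  have hcopN : (N / q₀ * q₀ * p).Coprime (NumberField.discr K).natAbs := by
    rw [hmul]; exact coprime_mul_discr_of_split hIQ hp hsp hcop
  have hpN : ¬ p ∣ N / q₀ * q₀ := by
    rw [hNc]; exact not_dvd_conductorNorm_of_hasGoodReductionAtPrime W hX.1.1
  have hsplit : ∀ ℓ : ℕ, ℓ.Prime → ℓ ∣ N / q₀ → ((Ideal.span {(ℓ : ℤ)}).primesOver (𝓞 K)).ncard = 2 :=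
    fun ℓ hℓ hℓd => hspl ℓ hℓ (ne_of_dvd_div hqN hq2 hℓd).1 (ne_of_dvd_div hqN hq2 hℓd).2
  have hinert : ∀ ℓ : ℕ, ℓ.Prime → ℓ ∣ q₀ → ((Ideal.span {(ℓ : ℤ)}).primesOver (𝓞 K)).ncard = 1 := by
    intro ℓ hℓ hℓd
    obtain rfl := (Nat.prime_dvd_prime_iff_eq hℓ hq₀).mp hℓd
    exact hin
  have hL0 : W.LFunction p = 0 := by
    rw [W.LFunction_apply_prime_eq_frobeniusTrace p hX.1.1]; exact ha0
  have hirr : W.HasIrreducibleModPGaloisRep p := Rank1Residual.ClassX6.irr W p hp hX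
  exact hPW K S p W hIQ hp hNc hsq hcopN hpN hsplit hinert hL0 hirr φ hφ0 hφ hnorm T

/-! ### §2. Cμ′ ⊕ (P4a) ⟹ Cμ, pointwise in the package's binders -/

/-- **The old stub Cμ from the reshaped stub Cμ′ and Pollack–Weston Thm. 2.5, pointwise.** In the binders of
`stub_definitePackageMu` that matter here (`W`, `K`, `p`, `N = N_W`, the definite-CR prime `q₀`, the anticyclotomic data
`κ₁ κ₂ v̄ γ₁ γ₂`, the Greenberg series `G`, the structure map `J`, the sign `ε`): if the signed two-variable package
`(ξ, 𝓛sig)` exists with (P1) the characteristic-ideal identity, (P2)/(P3) the cyclotomic specialisations, and — in place of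
unit content — a DEFINITE `μ`-CARRIER (a Brandt setup `S` of type `(N/q₀, q₀)`, a PW-normalised generator `φ` of the
`a(W)`-eigen-line, a tower `T` of Gross points, with `T.HasMuZeroLAc p φ → HasUnitContent (UnrSeries₂.minus 𝓛sig)`), then the
package exists WITH `HasUnitContent (UnrSeries₂.minus 𝓛sig)` — the conclusion of Cμ verbatim — GRANTED the named fact
`pollackWeston2011_thm_2_5_hasMuZeroLAc` (`hPW`), applied to that very carrier (`hasMuZeroLAc_of_pollackWeston`). The printed
sentence: "(𝓛^{∘,ac}_p(g_{/L})) = (∏ c_q(g) · 𝓛^∘_𝒲(g_{/L})) … and so `μ(𝓛^∘_p(g_{/L})) = 0`". CONDITIONAL; closes nothing.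
[cite: BurungaleSkinnerTianWan2024, II §2.2.2 (proof, case (def))] [cite: PollackWeston2011, Thm. 2.5 (i)] -/
theorem exists_package_of_muCarrier
    (hPW : ∀ (K : Type) [Field K] [NumberField K] {Nplus Nminus : ℕ} (S : Brandt.XiSetup Nplus Nminus)
      (p : ℕ) [Fact p.Prime] (W : WeierstrassCurve ℚ), pollackWeston2011_thm_2_5_hasMuZeroLAc K S p W)
    {p : ℕ} [Fact p.Prime] (W : WeierstrassCurve ℚ) [W.IsElliptic] [W.IsGloballyMinimal]
    (K : Type) [Field K] [NumberField K] (vbar : HeightOneSpectrum (𝓞 K))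
    (κ₁ κ₂ : ZpExtension K p) (γ₁ γ₂ : absoluteGaloisGroup K) [Fact (ZpExtension.IsTopGeneratorPair κ₁ κ₂ γ₁ γ₂)]
    {N : ℕ} [NeZero N] (f : CuspForm (Gamma0 N) 2)
    (hN : (N : ℤ) = W.conductorNorm ℤ) (hp : p ≠ 2) (ha0 : W.frobeniusTrace p = 0) (hIQ : IsImaginaryQuadratic K)
    (hsp : ((Ideal.span {(p : ℤ)}).primesOver (𝓞 K)).ncard = 2) (hcop : IsCoprime (N : ℤ) (NumberField.discr K))
    (hX : Rank1Residual.ClassX6 W p) {q₀ : ℕ} (hq₀ : q₀.Prime) (hqN : q₀ ∣ N) (hq2 : ¬ (q₀ ^ 2 ∣ N))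
    (hin : ((Ideal.span {(q₀ : ℤ)}).primesOver (𝓞 K)).ncard = 1)
    (hspl : ∀ ℓ : ℕ, ℓ.Prime → ℓ ∣ N → ℓ ≠ q₀ → ((Ideal.span {(ℓ : ℤ)}).primesOver (𝓞 K)).ncard = 2)
    (G : PowerSeries (PowerSeries (PadicComplexInt p))) (J : ℤ_[p] →+* PadicComplexInt p) (ε : ℤˣ)
    (hC' : ∃ xi Lsig : PowerSeries (PowerSeries (PadicComplexInt p)),
      (∃ (S : Brandt.XiSetup (N / q₀) q₀) (_ : Fintype (Brandt.ClassSet S.O))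
          (φ : Brandt.ClassSet S.O → ℤ) (T : GrossPointTower K S p),
          φ ≠ 0 ∧
          Brandt.eigenLattice (N / q₀ * q₀) (Brandt.matrix S.O) (fun n => W.LFunction n) = ℤ ∙ φ ∧
          (∃ c : Brandt.ClassSet S.O, ¬ (p : ℤ) ∣ (Brandt.weight S.O c : ℤ) * φ c) ∧
          (T.HasMuZeroLAc p φ → GreenbergVatsal2000.HasUnitContent (UnrSeries₂.minus Lsig))) ∧
      (Ideal.span {xi * G} =
          (WeierstrassCurve.XGr₂.charIdeal (W.baseChange K) p κ₁ κ₂ vbar γ₁ γ₂).map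
              (IwasawaAlgebra₂.toUnr₂ p J) * Ideal.span {Lsig} ∧
      ∀ (κ : ZpExtension ℚ p) (γ : absoluteGaloisGroup ℚ), κ.IsCyclotomic → κ.IsTopGenerator γ →
        IsCyclotomicVariable p γ →
        (∃ ζ : ℤ_[p]ˣ, IsOfFinOrder ζ ∧
          GaloisRep.cyclotomicCharacter ℚ p γ * ζ = GaloisRep.cyclotomicCharacter K p γ₁) →
        ∀ (W₂ : WeierstrassCurve ℚ) [W₂.IsElliptic] [W₂.IsGloballyMinimal]
          (C₂ : WeierstrassCurve.VariableChange ℚ),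
          C₂ • W₂ = W.quadraticTwist (NumberField.discr K : ℚ) →
          (∀ (D₁ : Kobayashi2003.SignedSelmerDualData W κ γ ε)
              (D₂ : Kobayashi2003.SignedSelmerDualData W₂ κ γ ε) (g₁ g₂ : IwasawaAlgebra p),
              D₁.charIdeal = Ideal.span {g₁} → D₂.charIdeal = Ideal.span {g₂} →
              UnrSeries₂.plus xi ∣ PowerSeries.map J (g₁ * g₂)) ∧
          (∀ {N₂ : ℕ} [NeZero N₂] (f₂ : CuspForm (Gamma0 N₂) 2), IsNewformOf W₂ f₂ →
            ∀ (L₁ L₂ : IwasawaAlgebra p), Kobayashi2003.IsSignedPAdicLFunction f p ε L₁ →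
              Kobayashi2003.IsSignedPAdicLFunction f₂ p ε L₂ →
              ∃ u : PowerSeries (PadicComplexInt p), IsUnit u ∧
                UnrSeries₂.plus Lsig = u * PowerSeries.map J (L₁ * L₂)))) :
    ∃ xi Lsig : PowerSeries (PowerSeries (PadicComplexInt p)),
      GreenbergVatsal2000.HasUnitContent (UnrSeries₂.minus Lsig) ∧
      (Ideal.span {xi * G} =
          (WeierstrassCurve.XGr₂.charIdeal (W.baseChange K) p κ₁ κ₂ vbar γ₁ γ₂).map
              (IwasawaAlgebra₂.toUnr₂ p J) * Ideal.span {Lsig} ∧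
      ∀ (κ : ZpExtension ℚ p) (γ : absoluteGaloisGroup ℚ), κ.IsCyclotomic → κ.IsTopGenerator γ →
        IsCyclotomicVariable p γ →
        (∃ ζ : ℤ_[p]ˣ, IsOfFinOrder ζ ∧
          GaloisRep.cyclotomicCharacter ℚ p γ * ζ = GaloisRep.cyclotomicCharacter K p γ₁) →
        ∀ (W₂ : WeierstrassCurve ℚ) [W₂.IsElliptic] [W₂.IsGloballyMinimal]
          (C₂ : WeierstrassCurve.VariableChange ℚ),
          C₂ • W₂ = W.quadraticTwist (NumberField.discr K : ℚ) →
          (∀ (D₁ : Kobayashi2003.SignedSelmerDualData W κ γ ε)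
              (D₂ : Kobayashi2003.SignedSelmerDualData W₂ κ γ ε) (g₁ g₂ : IwasawaAlgebra p),
              D₁.charIdeal = Ideal.span {g₁} → D₂.charIdeal = Ideal.span {g₂} →
              UnrSeries₂.plus xi ∣ PowerSeries.map J (g₁ * g₂)) ∧
          (∀ {N₂ : ℕ} [NeZero N₂] (f₂ : CuspForm (Gamma0 N₂) 2), IsNewformOf W₂ f₂ →
            ∀ (L₁ L₂ : IwasawaAlgebra p), Kobayashi2003.IsSignedPAdicLFunction f p ε L₁ →
              Kobayashi2003.IsSignedPAdicLFunction f₂ p ε L₂ →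
              ∃ u : PowerSeries (PadicComplexInt p), IsUnit u ∧
                UnrSeries₂.plus Lsig = u * PowerSeries.map J (L₁ * L₂))) := by
  obtain ⟨xi, Lsig, ⟨S, _instF, φ, T, hφ0, hφ, hnorm, hμ⟩, hP1, hline⟩ := hC'
  exact ⟨xi, Lsig,
    hμ (hasMuZeroLAc_of_pollackWeston hPW W K hN hp ha0 hIQ hsp hcop hX hq₀ hqN hq2 hin hspl S φ hφ0 hφ hnorm T),
    hP1, hline⟩

end Summit.BirchSwinnertonDyer.BirchSwinnertonDyer.Theorems.SemistableDefmuMuCarrier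

end
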